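import Summits.RiemannHypothesis.RiemannHypothesis.Theorems.JensenPolynomialsSkewFarInterface
import Summits.RiemannHypothesis.RiemannHypothesis.Theorems.JensenPolynomialsXiCumulantSkew98Far
import Summits.RiemannHypothesis.RiemannHypothesis.Theorems.JensenPolynomialsFarGumbelModeCM
import Summits.RiemannHypothesis.RiemannHypothesis.Theorems.JensenPolynomialsFarGumbelDefs
import HarnessLib

/-!
# Line `far-gumbel` (crux stmt-RiemannHypothesis-19465), stub S5 — the FAR WINDOW LAWS in the far-mode
# variable `υ`, from prover g4's landed Stein-moment interface (RH-FREE)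

The Stein-moment line of stmt-19466 (prover g4, CLOSED 2026-08-26) landed `SkewFar.far_interface`:
for `M ≥ 2·10¹⁸` there is `a ≥ 9.45` with `1.99/(4a+1) ≤ V := M·v ≤ 2.01/(4a+1)` and
`0 ≤ K := (M−3/2)(M−½)κ₃ ≤ 0.07`, and the closer's dictionary `delta_structure` / `skewWindow_structure`:
`2MΔ² = 1 + 1/(2b) − ((b−1)/b)V`, `b²ũ₃ = 2 − 6((b−1)/M)V + K` (`b = M − ½`). Here:

* `far_interface_xiMode` — the same interface with `a = xiMode (2M)` EXPOSED (assembly copied verbatim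
  from `SkewFar.far_interface`; all inputs are prover g4's landed lemmas);
* `deltaSq_far_law` — (W2) `|2(M−½)Δ² − (1 − ε/2 + ε²/8)| ≤ 1/200`, `ε = 1/υ`, `υ` the far mode
  (`a ∈ [υ, (1+10⁻⁹)υ]` by eng g5's `envMode_le_xiMode` / `xiMode_le_envMode_mul`); true size `≤ 3·10⁻⁴`;
* `u3_far_law` — (W3′) `|(M−½)²ũ₃ − (2 − 5ε/2 + 3ε²/2)| ≤ 7/100`. NOTE: the registered S5 asks `1/20`;
  from the landed interface only `7/100` follows, because `K`'s certified LOWER bound is `0` while the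
  law corresponds to `K ≈ ε/2 + 3ε²/4 ≈ 0.061` at the pin (STATUS 2026-08-26T13:15Z, re-pin ask).

WHAT THIS IS NOT: nothing here bears on zeros of `ζ` or the truth of RH. Landed
`--supports stmt-RiemannHypothesis-19465 --as helper` by prover-rh-jensen-eng-2-g2-0.
-/

set_option linter.dupNamespace false

namespace Summit.RiemannHypothesis.RiemannHypothesis.Theorems.JensenPolynomials.FarGumbel

open Literature.NumberTheory.LFunctions Literature.Probability.Distributions MeasureTheory Set Filter Real
open scoped Topology Nat
open Summit.RiemannHypothesis.RiemannHypothesis.Theorems.JensenPolynomials.SkewFar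

set_option maxHeartbeats 1600000 in -- long interval bookkeeping in a large context, no search
/-- **Interface with the mode exposed** (prover g4's `SkewFar.far_interface`, assembly copied verbatim,
with `a := xiMode (2M)` named instead of `∃ a`): for `M = m + 3 ≥ 2·10¹⁸`, `a = a_{2M} ≥ 9.45` and
`1.99/(4a+1) ≤ M·v ≤ 2.01/(4a+1)` and `0 ≤ (M−3/2)(M−5/2)·κ₃ ≤ 0.07`, where `v`, `κ₃` are the relative variance and the
normalised third central moment of `u⁻²` under `ν_{2M}`, written through `xiMoment`. -/
theorem far_interface_xiMode (m : ℕ) (hm : 2 * 10 ^ 18 ≤ m + 3) :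
    189 / 20 ≤ xiMode ((2 * m + 6 : ℕ) : ℝ) ∧
      ((m : ℝ) + 3) * (xiMoment (2 * m + 2) * xiMoment (2 * m + 6) / xiMoment (2 * m + 4) ^ 2 - 1) ≤ 2.01 / (4 * xiMode ((2 * m + 6 : ℕ) : ℝ) + 1) ∧
      1.99 / (4 * xiMode ((2 * m + 6 : ℕ) : ℝ) + 1) ≤ ((m : ℝ) + 3) * (xiMoment (2 * m + 2) * xiMoment (2 * m + 6) / xiMoment (2 * m + 4) ^ 2 - 1) ∧
      0 ≤ ((m : ℝ) + 3 / 2) * ((m : ℝ) + 1 / 2) *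
        ((xiMoment (2 * m) * xiMoment (2 * m + 6) ^ 2 - 3 * xiMoment (2 * m + 2) * xiMoment (2 * m + 4) * xiMoment (2 * m + 6)
          + 2 * xiMoment (2 * m + 4) ^ 3) / xiMoment (2 * m + 4) ^ 3) ∧
      ((m : ℝ) + 3 / 2) * ((m : ℝ) + 1 / 2) *
        ((xiMoment (2 * m) * xiMoment (2 * m + 6) ^ 2 - 3 * xiMoment (2 * m + 2) * xiMoment (2 * m + 4) * xiMoment (2 * m + 6)
          + 2 * xiMoment (2 * m + 4) ^ 3) / xiMoment (2 * m + 4) ^ 3) ≤ 0.07 := by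
  set s : ℕ := 2 * m + 6 with hs_def
  have hs : 4 * 10 ^ 18 ≤ s := by omega
  have e2 : s - 2 = 2 * m + 4 := by omega
  have e4 : s - 4 = 2 * m + 2 := by omega
  have e6 : s - 6 = 2 * m := by omega
  obtain ⟨ha0, ha, _, _⟩ := mode_facts s hs
  obtain ⟨hApos, _, _, hR0, hc0, _, hRω1, hRω2⟩ :=
    consts_facts s hs (A := 4 * π * exp (4 * xiMode (s : ℝ))) (R := _) (c := _) rfl rfl rfl
  obtain ⟨_, _, _, hκ1, hκ2⟩ := const_sizes s hs (A := 4 * π * exp (4 * xiMode (s : ℝ))) (R := _) (c := _) rfl rfl rfl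
    (l := xiMode (s : ℝ) / Real.sqrt s) rfl
  have hRbig := R_large s hs (A := 4 * π * exp (4 * xiMode (s : ℝ))) (R := _) (c := _) rfl rfl rfl
  have hP := P_bound s hs (A := 4 * π * exp (4 * xiMode (s : ℝ))) (R := _) (c := _) (P := _) rfl rfl rfl rfl
  have hQ := Q_bound s hs (A := 4 * π * exp (4 * xiMode (s : ℝ))) (R := _) (c := _) (Q := _) rfl rfl rfl rfl
  have hT := T_bound s hs (A := 4 * π * exp (4 * xiMode (s : ℝ))) (R := _) (c := _) (T := _) rfl rfl rfl rfl
  have h6 := pow_six_le s hs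
  rw [e2] at hP hQ hT
  rw [e4] at hQ hT
  rw [e6] at hT
  set a := xiMode (s : ℝ) with ha_def
  set A := 4 * π * exp (4 * a) with hA
  set R := 4 * A + s / a ^ 2 with hR
  set c := 8 * A - s / a ^ 3 with hc
  set κ := c / R with hκ
  set m₀ := xiMoment s with hm₀
  set m₁ := xiMoment (2 * m + 4) with hm₁
  set m₂ := xiMoment (2 * m + 2) with hm₂
  set m₃ := xiMoment (2 * m) with hm₃
  set P := a ^ 3 * R * (m₁ / m₀ - 1 / a ^ 2) with hPdef
  set Q := a ^ 6 * R * (m₂ / m₀ - 2 * m₁ / (a ^ 2 * m₀) + 1 / a ^ 4) with hQdef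
  set T := a ^ 9 * R ^ 2 * (m₃ / m₀ - 3 * m₂ / (a ^ 2 * m₀) + 3 * m₁ / (a ^ 4 * m₀) - 1 / a ^ 6) with hTdef
  have hm0 : 0 < m₀ := xiMoment_pos _
  have hm1 : 0 < m₁ := xiMoment_pos _
  have hsR : ((s : ℕ) : ℝ) = 2 * ((m : ℝ) + 3) := by rw [hs_def]; push_cast; ring
  -- derived quantities
  have h3a : 3 / a ≤ 3 / (189 / 20) := div_le_div_of_nonneg_left (by norm_num) (by norm_num) ha
  have h3a0 : 0 < 3 / a := by positivity
  have hPabs : |P| ≤ 4.4 := by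
    have h := abs_le.1 hP
    rw [abs_le]; constructor <;> linarith [h.1, h.2]
  have hp : |P / (a * R)| ≤ 1e-17 := by
    rw [abs_div, abs_of_pos (mul_pos ha0 hR0), div_le_iff₀ (mul_pos ha0 hR0)]
    have haR : (189 / 20) * 1e17 ≤ a * R := mul_le_mul ha hRbig (by norm_num) ha0.le
    linarith
  obtain ⟨hp1, hp2⟩ := abs_le.1 hp
  set p := P / (a * R) with hpdef
  have h1p : 0 < 1 + p := by linarith
  have hV := relVar_eq_PQ hm0.ne' hm1.ne' ha0.ne' hR0.ne' hPdef hQdef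
  have hK := kappa3_eq_PQT hm0.ne' hm1.ne' ha0.ne' hR0.ne' hPdef hQdef hTdef
  rw [← hpdef] at hV hK
  have hs' : (4 * 10 ^ 18 : ℝ) ≤ (s : ℝ) := by exact_mod_cast hs
  have hspos : (0 : ℝ) < s := by linarith
  set W := R * a ^ 2 / s with hW
  have hW0 : 0 < W := by positivity
  have hW1 : 4 * a + 1 ≤ W := hRω1
  -- `a²/s ≤ 10⁻¹⁵`
  have has : a ^ 2 / (s : ℝ) ≤ 1e-15 := by
    rw [div_le_iff₀ hspos]
    have ha4 : (7974 : ℝ) ≤ a ^ 4 := by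
      have h := pow_le_pow_left₀ (by norm_num) ha 4; norm_num at h; linarith
    have h1 : 1000 * a ^ 2 ≤ a ^ 6 := by
      calc 1000 * a ^ 2 ≤ a ^ 4 * a ^ 2 := mul_le_mul_of_nonneg_right (by linarith) (sq_nonneg a)
        _ = a ^ 6 := by ring
    linarith
  have hW2 : W ≤ (4 * a + 1) * (1 + 1e-15) := by
    have h1 : W ≤ 4 * a + 1 + 37 * (a ^ 2 / s) := hRω2
    have e : (4 * a + 1) * (1 + 1e-15) = 4 * a + 1 + 1e-15 * (4 * a + 1) := by ring
    rw [e]; linarith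
  -- `(m+3)·v = (Q − P²/R)/(2W(1+p)²)`
  have hMv : ((m : ℝ) + 3) * (m₂ * m₀ / m₁ ^ 2 - 1) = (Q - P ^ 2 / R) / (2 * W * (1 + p) ^ 2) := by
    rw [hV, hW]
    have hm3 : (m : ℝ) + 3 = (s : ℝ) / 2 := by rw [hsR]; ring
    rw [hm3]
    field_simp
  have hP2R : 0 ≤ P ^ 2 / R := by positivity
  have hP2R' : P ^ 2 / R ≤ 2e-16 := by
    rw [div_le_iff₀ hR0]
    have hP2 : P ^ 2 ≤ 4.4 ^ 2 := by rw [← sq_abs]; exact pow_le_pow_left₀ (abs_nonneg _) hPabs 2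
    linarith
  obtain ⟨hQ1, hQ2⟩ := abs_le.1 hQ
  obtain ⟨hT1, hT2⟩ := abs_le.1 hT
  obtain ⟨hP1, hP2'⟩ := abs_le.1 hP
  have ha1 : 0 < 4 * a + 1 := by linarith
  -- `N = T − 3PQ + 2P³/R`
  have hPpos : 0 < P := by
    have : 3 / a > 0 := by positivity
    linarith
  have hPQ1 : (2 * κ + 3 / a - 0.011) * (4 - 1e-4) ≤ P * Q :=
    mul_le_mul (by linarith) (by linarith) (by norm_num) hPpos.le
  have hPQ2 : P * Q ≤ (2 * κ + 3 / a + 0.011) * (4 + 1e-4) :=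
    mul_le_mul (by linarith) (by linarith) (by linarith) (by linarith)
  have hP3 : 0 ≤ 2 * P ^ 3 / R := by positivity
  have hP3' : 2 * P ^ 3 / R ≤ 2e-15 := by
    rw [div_le_iff₀ hR0]
    have hP44 : P ≤ 4.4 := by linarith
    have : P ^ 3 ≤ 4.4 ^ 3 := pow_le_pow_left₀ hPpos.le hP44 3
    linarith
  have e108 : (108 : ℝ) / a = 36 * (3 / a) := by ring
  have e72a : (71.99 : ℝ) / a = 71.99 / 3 * (3 / a) := by ring
  have e72b : (72.01 : ℝ) / a = 72.01 / 3 * (3 / a) := by ring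
  rw [e108] at hT1 hT2
  have hN1 : 15.99 * κ + 71.99 / a - 0.34 ≤ T - 3 * P * Q + 2 * P ^ 3 / R := by
    rw [e72a]; linarith [hPQ2, hP3, hT1]
  have hN2 : T - 3 * P * Q + 2 * P ^ 3 / R ≤ 16.001 * κ + 72.01 / a + 0.34 := by
    rw [e72b]; linarith [hPQ1, hP3', hT2]
  have hNpos : 0 < T - 3 * P * Q + 2 * P ^ 3 / R := by linarith
  -- `(b−1)(b−2)κ₃ = ((s−3)(s−5)/s²)·(a/(4W²))·N/(1+p)³`
  have hKid : ((m : ℝ) + 3 / 2) * ((m : ℝ) + 1 / 2) * ((m₃ * m₀ ^ 2 - 3 * m₂ * m₁ * m₀ + 2 * m₁ ^ 3) / m₁ ^ 3) =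
      (((m : ℝ) + 3 / 2) * ((m : ℝ) + 1 / 2) / ((m : ℝ) + 3) ^ 2) * (a / (4 * W ^ 2)) *
        ((T - 3 * P * Q + 2 * P ^ 3 / R) / (1 + p) ^ 3) := by
    rw [hK, hW, hsR]
    field_simp
    ring
  have hfrac0 : 0 ≤ ((m : ℝ) + 3 / 2) * ((m : ℝ) + 1 / 2) / ((m : ℝ) + 3) ^ 2 := by positivity
  have hfrac1 : ((m : ℝ) + 3 / 2) * ((m : ℝ) + 1 / 2) / ((m : ℝ) + 3) ^ 2 ≤ 1 := by
    rw [div_le_one (by positivity)]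
    have hm0' : (0 : ℝ) ≤ m := Nat.cast_nonneg m
    have e : ((m : ℝ) + 3) ^ 2 - ((m : ℝ) + 3 / 2) * ((m : ℝ) + 1 / 2) = 4 * m + 33 / 4 := by ring
    linarith
  refine ⟨ha, ?_, ?_, ?_, ?_⟩
  · -- upper bound for `M·v`
    rw [hMv]
    have hden : 2 * (4 * a + 1) * (1 - 1e-17) ^ 2 ≤ 2 * W * (1 + p) ^ 2 := by
      have h1 : (1 - 1e-17) ^ 2 ≤ (1 + p) ^ 2 := pow_le_pow_left₀ (by norm_num) (by linarith only [hp1]) 2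
      exact mul_le_mul (by linarith only [hW1]) h1 (by positivity) (by positivity)
    calc (Q - P ^ 2 / R) / (2 * W * (1 + p) ^ 2) ≤ 4.0001 / (2 * (4 * a + 1) * (1 - 1e-17) ^ 2) :=
          div_le_div₀ (by norm_num) (by linarith only [hQ2, hP2R]) (by positivity) hden
      _ ≤ 2.01 / (4 * a + 1) := by
          rw [div_le_div_iff₀ (by positivity) ha1]
          exact (aux_v ha).1
  · -- lower bound for `M·v`
    rw [hMv]
    have hden : 2 * W * (1 + p) ^ 2 ≤ 2 * ((4 * a + 1) * (1 + 1e-15)) * (1 + 1e-17) ^ 2 := by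
      have h1 : (1 + p) ^ 2 ≤ (1 + 1e-17) ^ 2 := pow_le_pow_left₀ h1p.le (by linarith only [hp2]) 2
      exact mul_le_mul (by linarith only [hW2]) h1 (by positivity) (by positivity)
    calc 1.99 / (4 * a + 1) ≤ 3.9998 / (2 * ((4 * a + 1) * (1 + 1e-15)) * (1 + 1e-17) ^ 2) := by
          rw [div_le_div_iff₀ ha1 (by positivity)]
          exact (aux_v ha).2
      _ ≤ (Q - P ^ 2 / R) / (2 * W * (1 + p) ^ 2) :=
          div_le_div₀ (by linarith only [hQ1, hP2R']) (by linarith only [hQ1, hP2R']) (by positivity) hden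
  · -- `K ≥ 0`
    rw [hKid]
    positivity
  · -- `K ≤ 0.07`
    rw [hKid]
    have hp3 : (1 - 1e-17) ^ 3 ≤ (1 + p) ^ 3 := pow_le_pow_left₀ (by norm_num) (by linarith only [hp1]) 3
    have hW2sq : (4 * a + 1) ^ 2 ≤ W ^ 2 := pow_le_pow_left₀ ha1.le hW1 2
    have hmid : a / (4 * W ^ 2) ≤ a / (4 * (4 * a + 1) ^ 2) :=
      div_le_div_of_nonneg_left ha0.le (by positivity) (by linarith only [hW2sq])
    have hlast : (T - 3 * P * Q + 2 * P ^ 3 / R) / (1 + p) ^ 3 ≤ (16.001 * κ + 72.01 / a + 0.34) / (1 - 1e-17) ^ 3 :=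
      div_le_div₀ (by linarith only [hN2, hNpos]) hN2 (by norm_num) hp3
    have hprod := mul_le_mul (mul_le_mul hfrac1 hmid (by positivity) zero_le_one) hlast (by positivity)
      (by positivity)
    refine hprod.trans ?_
    rw [one_mul, div_mul_div_comm, div_le_iff₀ (by positivity)]
    exact aux_K ha hκ2 (by linarith only [hκ1])

/-! ## The window laws in the far-mode variable `υ` -/

/-- Real-variable core of (W2): `|1/(2υ) − 1/(8υ²) − V(1 − 3/(2M))| ≤ 1/200` from the interface bounds
`1.99/(4a+1) ≤ V ≤ 2.01/(4a+1)`, `υ ≤ a ≤ (1+10⁻⁹)υ`, `υ ≥ 189/20`, `M ≥ 2·10¹⁸` (true size `≤ 3·10⁻⁴`). -/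
private theorem core_W2 {M υ a V : ℝ} (hM : 2 * 10 ^ 18 ≤ M) (hυ : 189 / 20 ≤ υ) (hυa : υ ≤ a)
    (haυ : a ≤ (1 + 1 / 10 ^ 9) * υ) (hVup : V ≤ 2.01 / (4 * a + 1)) (hVlo : 1.99 / (4 * a + 1) ≤ V) :
    |1 - (1 - 3 / (2 * M)) * V - (1 - 1 / (2 * υ) + 1 / (8 * υ ^ 2))| ≤ 1 / 200 := by
  have hυ0 : 0 < υ := by linarith
  have ha0 : 0 < a := by linarith
  have hA : 0 < 4 * a + 1 := by linarith
  have hM0 : 0 < M := by linarith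
  have hV0 : 0 ≤ V := le_trans (by positivity) hVlo
  have hVA : V * (4 * a + 1) ≤ 2.01 := (le_div_iff₀ hA).mp hVup
  have hVA' : 1.99 ≤ V * (4 * a + 1) := (div_le_iff₀ hA).mp hVlo
  have hVU : V * (4 * υ + 1) ≤ 2.01 := by nlinarith
  -- rewrite the target as `1/(2υ) − 1/(8υ²) − V + 3V/(2M)`
  have hre : 1 - (1 - 3 / (2 * M)) * V - (1 - 1 / (2 * υ) + 1 / (8 * υ ^ 2)) =
      1 / (2 * υ) - 1 / (8 * υ ^ 2) - V + 3 * V / (2 * M) := by ring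
  rw [hre, abs_le]
  constructor
  · -- lower: `V ≤ 2.01/(4υ+1) ≤ 1/(2υ) − 1/(8υ²) + 1/200`
    have h3 : 0 ≤ 3 * V / (2 * M) := by positivity
    have key : V ≤ 1 / (2 * υ) - 1 / (8 * υ ^ 2) + 1 / 200 := by
      have h1 : V ≤ 2.01 / (4 * υ + 1) := by rw [le_div_iff₀ (by linarith)]; exact hVU
      have h2 : 2.01 / (4 * υ + 1) ≤ 1 / (2 * υ) - 1 / (8 * υ ^ 2) + 1 / 200 := by
        rw [div_le_iff₀ (by linarith)]
        have e : (1 / (2 * υ) - 1 / (8 * υ ^ 2) + 1 / 200) * (4 * υ + 1) =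
            2 - 1 / (8 * υ ^ 2) + (4 * υ + 1) / 200 := by field_simp; ring
        rw [e]
        have h8 : 1 / (8 * υ ^ 2) ≤ 1 / (8 * (189 / 20) ^ 2) := by
          apply one_div_le_one_div_of_le (by positivity); nlinarith
        norm_num at h8 ⊢; linarith
      exact h1.trans h2
    linarith
  · -- upper: `V ≥ 1.99/((1+10⁻⁹)(4υ+1))` and `3V/(2M)` tiny
    have hA' : 4 * a + 1 ≤ (1 + 1 / 10 ^ 9) * (4 * υ + 1) := by nlinarith
    have hVlo' : 1.99 ≤ V * ((1 + 1 / 10 ^ 9) * (4 * υ + 1)) := by nlinarith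
    have h3 : 3 * V / (2 * M) ≤ 1 / 10 ^ 18 := by
      rw [div_le_iff₀ (by positivity)]
      have : V ≤ 2.01 := by nlinarith
      nlinarith
    have h8 : 0 ≤ 1 / (8 * υ ^ 2) := by positivity
    -- `1/(2υ) − V ≤ 1/(2υ) − 1.99/((1+10⁻⁹)(4υ+1)) ≤ 0.004`
    have key : 1 / (2 * υ) - V ≤ 1 / 250 := by
      have hden : 0 < (1 + 1 / 10 ^ 9) * (4 * υ + 1) := by positivity
      have hV1 : 1.99 / ((1 + 1 / 10 ^ 9) * (4 * υ + 1)) ≤ V := by rw [div_le_iff₀ hden]; exact hVlo'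
      have h2 : 1 / (2 * υ) - 1.99 / ((1 + 1 / 10 ^ 9) * (4 * υ + 1)) ≤ 1 / 250 := by
        rw [div_sub_div _ _ (by positivity) hden.ne', div_le_iff₀ (by positivity)]
        nlinarith
      linarith
    linarith

/-- Real-variable core of (W3′): `|−6(1 − 3/(2M))V + K + 5/(2υ) − 3/(2υ²)| ≤ 7/100` from the interface
bounds and `0 ≤ K ≤ 0.07`. -/
private theorem core_W3 {M υ a V K : ℝ} (hM : 2 * 10 ^ 18 ≤ M) (hυ : 189 / 20 ≤ υ) (hυa : υ ≤ a)
    (haυ : a ≤ (1 + 1 / 10 ^ 9) * υ) (hVup : V ≤ 2.01 / (4 * a + 1)) (hVlo : 1.99 / (4 * a + 1) ≤ V)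
    (hK0 : 0 ≤ K) (hK1 : K ≤ 0.07) :
    |2 - 6 * (1 - 3 / (2 * M)) * V + K - (2 - 5 / (2 * υ) + 3 / (2 * υ ^ 2))| ≤ 7 / 100 := by
  have hυ0 : 0 < υ := by linarith
  have ha0 : 0 < a := by linarith
  have hA : 0 < 4 * a + 1 := by linarith
  have hM0 : 0 < M := by linarith
  have hV0 : 0 ≤ V := le_trans (by positivity) hVlo
  have hVA : V * (4 * a + 1) ≤ 2.01 := (le_div_iff₀ hA).mp hVup
  have hVA' : 1.99 ≤ V * (4 * a + 1) := (div_le_iff₀ hA).mp hVlo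
  have hVU : V * (4 * υ + 1) ≤ 2.01 := by nlinarith
  have hre : 2 - 6 * (1 - 3 / (2 * M)) * V + K - (2 - 5 / (2 * υ) + 3 / (2 * υ ^ 2)) =
      -6 * V + 9 * V / M + K + 5 / (2 * υ) - 3 / (2 * υ ^ 2) := by ring
  rw [hre, abs_le]
  constructor
  · -- lower: `−6V + 5/(2υ) − 3/(2υ²) ≥ −7/100` using `6V ≤ 12.06/(4υ+1)`
    have h9 : 0 ≤ 9 * V / M := by positivity
    have h1 : 6 * V ≤ 12.06 / (4 * υ + 1) := by rw [le_div_iff₀ (by linarith)]; nlinarith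
    have h2 : -(7 / 100 : ℝ) ≤ -(12.06 / (4 * υ + 1)) + 5 / (2 * υ) - 3 / (2 * υ ^ 2) := by
      have hU : 0 < 4 * υ + 1 := by linarith
      have e : -(12.06 / (4 * υ + 1)) + 5 / (2 * υ) - 3 / (2 * υ ^ 2) =
          (-24.12 * υ ^ 2 + 5 * υ * (4 * υ + 1) - 3 * (4 * υ + 1)) / (2 * υ ^ 2 * (4 * υ + 1)) := by
        field_simp; ring
      rw [e, le_div_iff₀ (by positivity)]
      have hυ' : 0 ≤ υ - 189 / 20 := by linarith
      nlinarith [mul_nonneg hυ' hυ0.le, mul_nonneg (mul_nonneg hυ' hυ0.le) hυ0.le]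
    linarith
  · -- upper: `−6(1 − 3/(2M))V + 5/(2υ) ≤ 0` using `6V ≥ 11.94/((1+10⁻⁹)(4υ+1))`, then `+ K ≤ 0.07`
    have hA' : 4 * a + 1 ≤ (1 + 1 / 10 ^ 9) * (4 * υ + 1) := by nlinarith
    have hVlo' : 1.99 ≤ V * ((1 + 1 / 10 ^ 9) * (4 * υ + 1)) := by nlinarith
    have h3 : 0 ≤ 3 / (2 * υ ^ 2) := by positivity
    have hfac : (1 - 1 / 10 ^ 18 : ℝ) ≤ 1 - 3 / (2 * M) := by
      have : 3 / (2 * M) ≤ 1 / 10 ^ 18 := by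
        rw [div_le_div_iff₀ (by positivity) (by positivity)]; linarith
      linarith
    have hden : 0 < (1 + 1 / 10 ^ 9) * (4 * υ + 1) := by positivity
    have hV1 : 11.94 / ((1 + 1 / 10 ^ 9) * (4 * υ + 1)) ≤ 6 * V := by
      rw [div_le_iff₀ hden]; nlinarith
    have hL0 : 0 ≤ 11.94 / ((1 + 1 / 10 ^ 9) * (4 * υ + 1)) := by positivity
    have hprod : (1 - 1 / 10 ^ 18) * (11.94 / ((1 + 1 / 10 ^ 9) * (4 * υ + 1))) ≤
        (1 - 3 / (2 * M)) * (6 * V) := mul_le_mul hfac hV1 hL0 (by linarith)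
    have hfold : -6 * V + 9 * V / M = -((1 - 3 / (2 * M)) * (6 * V)) := by
      field_simp; ring
    have key : -((1 - 1 / 10 ^ 18) * (11.94 / ((1 + 1 / 10 ^ 9) * (4 * υ + 1)))) + 5 / (2 * υ) ≤ 0 := by
      rw [show -((1 - 1 / 10 ^ 18) * (11.94 / ((1 + 1 / 10 ^ 9) * (4 * υ + 1)))) + 5 / (2 * υ) =
          (-(1 - 1 / 10 ^ 18) * 11.94 * (2 * υ) + 5 * ((1 + 1 / 10 ^ 9) * (4 * υ + 1))) /
            ((1 + 1 / 10 ^ 9) * (4 * υ + 1) * (2 * υ)) by field_simp]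
      rw [div_le_iff₀ (by positivity), zero_mul]
      nlinarith
    rw [hfold]
    linarith

/-- Cast bookkeeping: `xiMode` at `2(m+3)` as a natural versus `2m+6`. [folklore] -/
private theorem xiMode_cast_eq (m : ℕ) :
    xiMode (((2 * (m + 3) : ℕ)) : ℝ) = xiMode ((2 * m + 6 : ℕ) : ℝ) := by
  congr 1

/-- **(W2) the far Δ²-law**: `|2(M−½)Δ² − (1 − ε/2 + ε²/8)| ≤ 1/200` with `ε = 1/υ`, `υ` the far mode,
for every `M ≥ 2·10¹⁸` (from prover g4's `far_interface`, the closer's `delta_structure`, and eng g5's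
mode comparison). -/
theorem deltaSq_far_law (M : ℕ) (hM : 2 * 10 ^ 18 ≤ M) {υ : ℝ}
    (hυ : (189 / 20 : ℝ) ≤ υ ∧ 4 * π * exp (4 * υ) * υ = 2 * (M : ℝ) + 9 * υ) :
    |2 * ((M : ℝ) - 1 / 2) * gorttwDeltaSq xiTaylorCoeff M - (1 - 1 / (2 * υ) + 1 / (8 * υ ^ 2))| ≤
      1 / 200 := by
  obtain ⟨m, rfl⟩ : ∃ m, M = m + 3 := ⟨M - 3, by omega⟩
  obtain ⟨ha, hVup, hVlo, -, -⟩ := far_interface_xiMode m hM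
  have hlo := envMode_le_xiMode (m + 3) hM hυ
  have hhi := xiMode_le_envMode_mul (m + 3) hM hυ
  rw [xiMode_cast_eq] at hlo hhi
  set a := xiMode ((2 * m + 6 : ℕ) : ℝ) with ha_def
  set V := ((m : ℝ) + 3) * (xiMoment (2 * m + 2) * xiMoment (2 * m + 6) / xiMoment (2 * m + 4) ^ 2 - 1)
    with hV
  have hMR : (2 * 10 ^ 18 : ℝ) ≤ ((m + 3 : ℕ) : ℝ) := by exact_mod_cast hM
  have hstr := delta_structure m
  -- `2(M−½)Δ² = 1 − (1 − 3/(2M))V`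
  have hid : 2 * ((((m + 3 : ℕ)) : ℝ) - 1 / 2) * gorttwDeltaSq xiTaylorCoeff (m + 3) =
      1 - (1 - 3 / (2 * (((m + 3 : ℕ)) : ℝ))) * V := by
    have hM3 : (((m + 3 : ℕ)) : ℝ) = (m : ℝ) + 3 := by push_cast; ring
    rw [hM3]
    have hm0 : (0 : ℝ) ≤ m := Nat.cast_nonneg m
    have e1 : 2 * ((m : ℝ) + 3 - 1 / 2) * gorttwDeltaSq xiTaylorCoeff (m + 3) =
        (((m : ℝ) + 5 / 2) / ((m : ℝ) + 3)) * (2 * ((m : ℝ) + 3) * gorttwDeltaSq xiTaylorCoeff (m + 3)) := by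
      field_simp; ring
    rw [e1, hstr, hV]
    field_simp
    ring
  rw [hid]
  have hMR' : (2 * 10 ^ 18 : ℝ) ≤ (((m + 3 : ℕ)) : ℝ) := hMR
  exact core_W2 hMR' hυ.1 hlo hhi hVup hVlo

/-- **(W3′) the far ũ₃-law with tolerance `7/100`**: `|(M−½)²ũ₃ − (2 − 5ε/2 + 3ε²/2)| ≤ 7/100`,
`ε = 1/υ`, for every `M ≥ 2·10¹⁸` (from `far_interface` with `0 ≤ K ≤ 0.07`, the closer's
`skewWindow_structure`, and the mode comparison). The registered S5 tolerance `1/20` would need a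
certified lower bound `K ≥ 0.013` at the pin, which the landed interface does not provide. -/
theorem u3_far_law (M : ℕ) (hM : 2 * 10 ^ 18 ≤ M) {υ : ℝ}
    (hυ : (189 / 20 : ℝ) ≤ υ ∧ 4 * π * exp (4 * υ) * υ = 2 * (M : ℝ) + 9 * υ) :
    |((M : ℝ) - 1 / 2) ^ 2 * gorttwU3 xiTaylorCoeff M - (2 - 5 / (2 * υ) + 3 / (2 * υ ^ 2))| ≤
      7 / 100 := by
  obtain ⟨m, rfl⟩ : ∃ m, M = m + 3 := ⟨M - 3, by omega⟩
  obtain ⟨ha, hVup, hVlo, hK0, hK1⟩ := far_interface_xiMode m hM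
  have hlo := envMode_le_xiMode (m + 3) hM hυ
  have hhi := xiMode_le_envMode_mul (m + 3) hM hυ
  rw [xiMode_cast_eq] at hlo hhi
  set a := xiMode ((2 * m + 6 : ℕ) : ℝ) with ha_def
  set V := ((m : ℝ) + 3) * (xiMoment (2 * m + 2) * xiMoment (2 * m + 6) / xiMoment (2 * m + 4) ^ 2 - 1)
    with hV
  set K := ((m : ℝ) + 3 / 2) * ((m : ℝ) + 1 / 2) *
    ((xiMoment (2 * m) * xiMoment (2 * m + 6) ^ 2 - 3 * xiMoment (2 * m + 2) * xiMoment (2 * m + 4) * xiMoment (2 * m + 6)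
      + 2 * xiMoment (2 * m + 4) ^ 3) / xiMoment (2 * m + 4) ^ 3) with hK
  have hMR : (2 * 10 ^ 18 : ℝ) ≤ ((m + 3 : ℕ) : ℝ) := by exact_mod_cast hM
  have hstr := skewWindow_structure m
  have hid : ((((m + 3 : ℕ)) : ℝ) - 1 / 2) ^ 2 * gorttwU3 xiTaylorCoeff (m + 3) =
      2 - 6 * (1 - 3 / (2 * (((m + 3 : ℕ)) : ℝ))) * V + K := by
    have hM3 : (((m + 3 : ℕ)) : ℝ) = (m : ℝ) + 3 := by push_cast; ring
    rw [hM3]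
    have e1 : ((m : ℝ) + 3 - 1 / 2) ^ 2 = ((m : ℝ) + 5 / 2) ^ 2 := by ring
    rw [e1, hstr, hV, hK]
    have hm3 : ((m : ℝ) + 3) ≠ 0 := by positivity
    field_simp
    ring
  rw [hid]
  exact core_W3 hMR hυ.1 hlo hhi hVup hVlo hK0 hK1

end Summit.RiemannHypothesis.RiemannHypothesis.Theorems.JensenPolynomials.FarGumbel
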